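import Summits.BirchSwinnertonDyer.Rank1Residual.P2.PrintCf2DeuringGaloisSummandEigen
import Summits.BirchSwinnertonDyer.BirchSwinnertonDyer.Theorems.PrintCf2SplitBadTwoCMPrimaryLocalPinning
import Summits.BirchSwinnertonDyer.BirchSwinnertonDyer.Theorems.PrintCf2SplitBadTwoFramePinningDeuring
import Summits.BirchSwinnertonDyer.BirchSwinnertonDyer.Theorems.PrintCf2SplitBadTwoFrameFieldArithmetic
import Literature.NumberTheory.EllipticCurves.ComplexMultiplicationDeuringGaloisActionProofs
import HarnessLib

set_option autoImplicit false

/-!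
# Crux `PrintCf2.SplitBadTwoRankOneOfFacts` (stmt-BirchSwinnertonDyer-20368), road α v10.3, S3b′ TWIST step:
# THE PINNED SUMMAND `W* = ↥(endEigenPrimaryTorsion 2 π r₀)` IS DEURING'S `E[v̄^∞]` — granted the print
# `Deuring_galoisAction_cmPrimaryTorsion_split` (Rubin LNM 1716 Thm. 5.15 / Cor. 5.16), Frobenius at every
# unramified `w ≠ v̄` acts on it as `ψ(w) ∈ 𝓞_K` read modulo `v̄ᵏ`, and inertia at `w ≠ v̄` through `{±1}`
# (trivially where `ψ` is unramified)

Cell `bsd-print-cf2`, typer seat ty2 g30 (the DISCHARGE INTERFACE: leaf/frame predicate ⟹ hypotheses and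
conclusion shape of the cited theorem, sorry-free; `P2/` = the typer's Summits-side files), serving crux
stmt-BirchSwinnertonDyer-20368 (`Summits/BirchSwinnertonDyer/BirchSwinnertonDyer/Theorems/PrintCf2SplitBadTwo*`).
HONEST FRAMING: THEOREMS ONLY (no definition, no named fact, no `sorry`); the Literature named fact
`Deuring_galoisAction_cmPrimaryTorsion_split` (p667198, statement-only, cited) appears as the displayed
HYPOTHESIS `hD`; nothing here closes a crux or a stub; BSD is not proved by any of this; beyond-print
theorem: no.

THE TARGET (width memo `Cruxes/SplitBadTwoRankOneOfFacts/S3B-TWIST-RECIPE-w5g2.md` §2, typing target (D-Gal)):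
"`Γ_K` acts on the pinned summand `W* = W[v̄^∞]` through the GEOMETRIC `2`-adic avatar of `λ = (ψ_W ∘ c)⁻¹`:
for every finite `w ∤ 2` of good reduction and every arithmetic Frobenius `Φ` at `w`, `Φ • x = N • x` on
`W*[2ᵏ]` with `N ≡ ι⁻¹((ψ_W∘c)(ϖ_w)) (mod v̄ᵏ)`". In the v10 frame (`C • W = cm7^{(d)}`, `K` imaginary
quadratic, `2 = v v̄`, `ψ` of type `(1,0)` with `L(ψ, s) = L(W, s)`, `π² = π − 2` in `End_K(W_K)`,
`r₀² = r₀ − 2` in `ℤ₂`, and the PINNING CLAUSE `hpin` «`GreenbergSelmer.inertia v` acts on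
`↥((W.baseChange K).endEigenPrimaryTorsion 2 π r₀)` through `{±1}`» of `stub_restrictedMainConj_two_v10` /
`stub_restrictedControl_two`), this file proves:

* (file 1, `PrintCf2DeuringGaloisSummandEigen.lean`) an `End_K(E)`-stable subgroup of `E_K[2^∞]` with
  cyclic layers lies in ONE of the two eigen-summands; two such complementary subgroups ARE the eigen-summands;
* §2 `isPrimaryComponent_endEigenPrimaryTorsion_of_pinned` — **THE BRIDGE**: granted `hD`, in every v10
  frame the pinned module `(W.baseChange K).endEigenPrimaryTorsion 2 π r₀` IS Deuring's component at `v̄`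
  (`DeuringGaloisAction.IsPrimaryComponent (W.baseChange K) 2 ψ vbar _`) and its partner `… π (1 − r₀)` is
  the component at `v` (the print's `E[v̄^∞]` is an eigen-summand by §1; it satisfies the pinning clause
  at `v` by the print's inertia clause and `𝓞_K^× = {±1}`; -w2's `endEigenPrimaryTorsion_two_pinningClause_unique`);
* §3 degree one: `absNorm_eq_two_of_split` (`N(v̄) = 2`), `exists_int_sub_mem_pow` (`𝓞_K/v̄ᵏ ≅ ℤ/2ᵏ`:
  every `a ∈ 𝓞_K` is an integer modulo `v̄ᵏ`, by `Ideal.exists_mul_add_mem_pow_succ` and `ord_{v̄} 2 = 1`);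
* §4 consequences in the subtype currency of the stubs: `smul_eq_of_isArithFrobAt_of_pinned` (Frobenius at
  an unramified `w ≠ v̄` acts on `↥(… endEigenPrimaryTorsion 2 π r₀)` as any `N ≡ a_w (mod v̄ᵏ)`, where
  `wi.embedding a_w = ψ.valueAtUniformizer w` and `(a_w) = w`), `exists_int_smul_eq_of_isArithFrobAt_of_pinned`
  (the `∃`-form: at every level an integer `N ≡ a_w (mod v̄ᵏ)` with `σ • x = N • x`),
  `smul_eq_self_of_inertia_of_pinned` (inertia at an unramified `w ≠ v̄` acts trivially),
  `smul_eq_self_or_eq_neg_of_inertia_of_pinned` / `pinningClause_of_pinned_of_ne` (inertia at ANY `w ≠ v̄`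
  acts through `{±1}` — the pinning clause holds at every `w ≠ v̄`, not only at `v`).

What this does NOT do: read `a_w (mod v̄ᵏ)` in `ℚ̄₂` through the frame's `ι` (the identity
`N ≡ ι⁻¹((ψ∘c)(ϖ_w))`, i.e. `ι⁻¹ ∘ wi.embedding ∘ c` induces `v̄` — next file), package the level-wise
scalars as a continuous character (p664116 `CocyclicScalar.exists_continuousMonoidHom_forall_smul_eq` does),
or prove the print.

References: K. Rubin, LNM 1716 (1999), §5 Prop. 5.4, Thm. 5.15, Cor. 5.16; [SilvermanATAEC1994] Ch. II
Thm. 9.1–9.2, Prop. 10.4; R. Greenberg, LNM 1716 (1999) §2.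
-/

noncomputable section

open scoped Classical
open NumberField IsDedekindDomain WeierstrassCurve Field
open Literature.NumberTheory.EllipticCurves Literature.NumberTheory.GaloisRepresentations
open Literature.NumberTheory.EllipticCurves.DeuringGaloisAction
open Summit.BirchSwinnertonDyer.BirchSwinnertonDyer.Theorems.PrintCf2

namespace Summit.BirchSwinnertonDyer.Rank1Residual.P2.DeuringGaloisSummand

variable {K : Type} [Field K] [NumberField K]

open DeuringGaloisSummandEigen

/-! ## §2 The bridge: in a v10 frame the pinned summand is Deuring's `E[v̄^∞]` -/

section Frame

open Summit.BirchSwinnertonDyer.BirchSwinnertonDyer.Theorems.RamifiedSevenEllipticUnits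

variable {d : ℤ} {W : WeierstrassCurve ℚ} [W.IsElliptic] [W.IsGloballyMinimal] {C : VariableChange ℚ}
  {v vbar : HeightOneSpectrum (𝓞 K)} {ψ : HeckeCharacter K}

/-- `𝓞_K^× = {±1}` in a frame field (`θ² = −7`), in the `IsUnit` currency of the print's inertia clause.
[cite: NeukirchANT1999, Ch. I §7 (units of imaginary quadratic fields)] -/
theorem eq_one_or_eq_neg_one_of_isUnit (hK : IsImaginaryQuadratic K) {θ : K} (hθ : θ ^ 2 = -7)
    (u : 𝓞 K) (hu : IsUnit u) : u = 1 ∨ u = -1 := by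
  rcases FirstLayer.units_eq_one_or_eq_neg_one hK hθ hu.unit with h | h
  · left; rw [← hu.unit_spec, h, Units.val_one]
  · right; rw [← hu.unit_spec, h, Units.val_neg, Units.val_one]

/-- **THE BRIDGE.** Granted the print `Deuring_galoisAction_cmPrimaryTorsion_split`, in every v10 frame
(`C • W = cm7^{(d)}`, `d ≠ 0`; `K` imaginary quadratic, `2 = v v̄`; `c ≠ 1`; `ψ` of type `(1, 0)` with
`L(ψ, s) = L(W, s)`; `π² = π − 2`, `r₀² = r₀ − 2`; the PINNING CLAUSE at `v` for `(π, r₀)`), the pinned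
module `E[𝔮_{r₀}^∞] = (W.baseChange K).endEigenPrimaryTorsion 2 π r₀` IS Deuring's `v̄`-primary component
`E[v̄^∞]` — it has every printed property `DeuringGaloisAction.IsPrimaryComponent (W.baseChange K) 2 ψ vbar` —
and its partner `E[𝔮_{1−r₀}^∞]` is `E[v^∞]`; the two are complementary. Proof: the print's `E[v̄^∞]`,
`E[v^∞]` are `End`-stable with cyclic layers and complementary, hence ARE the two eigen-summands for some
root `ρ` (§1); `E[v̄^∞]` satisfies the pinning clause at `v` (print: inertia at `v ≠ v̄` acts through
`𝓞_K^× = {±1}`), so `ρ = r₀` by -w2's `endEigenPrimaryTorsion_two_pinningClause_unique`.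
[cite: Rubin1999, §5 Thm. 5.15 (ii), Cor. 5.16 (ii), Prop. 5.4] -/
theorem isPrimaryComponent_endEigenPrimaryTorsion_of_pinned
    (hD : Deuring_galoisAction_cmPrimaryTorsion_split)
    (hd0 : d ≠ 0) (hC : C • W = cm7.quadraticTwist (d : ℚ)) (hK : IsImaginaryQuadratic K)
    (hv : ((2 : ℕ) : 𝓞 K) ∈ v.asIdeal) (hvbar : ((2 : ℕ) : 𝓞 K) ∈ vbar.asIdeal) (hne : vbar ≠ v)
    (c : K ≃ₐ[ℚ] K) (hc : c ≠ 1) (hψ : ψ.HasInfinityType (fun _ ↦ 1) (fun _ ↦ 0))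
    (hL : ∀ s : ℂ, 3 / 2 < s.re → heckeLFunction ψ s = W.LSeries s)
    (π : (W.baseChange K).endRing) (hrel : (π : AddMonoid.End (W.baseChange K).geomPoints) * π = π - 2)
    {r₀ : ℤ_[2]} (hr₀ : r₀ * r₀ = r₀ - 2)
    (hpin : ∀ τ ∈ GreenbergSelmer.inertia v,
      ∀ x : ↥((W.baseChange K).endEigenPrimaryTorsion 2 π r₀), τ • x = x ∨ τ • x = -x) :
    IsPrimaryComponent (W.baseChange K) 2 ψ vbar ((W.baseChange K).endEigenPrimaryTorsion 2 π r₀) ∧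
    IsPrimaryComponent (W.baseChange K) 2 ψ v ((W.baseChange K).endEigenPrimaryTorsion 2 π (1 - r₀)) ∧
    (W.baseChange K).endEigenPrimaryTorsion 2 π (1 - r₀) ⊓ (W.baseChange K).endEigenPrimaryTorsion 2 π r₀ = ⊥ ∧
    (W.baseChange K).endEigenPrimaryTorsion 2 π (1 - r₀) ⊔ (W.baseChange K).endEigenPrimaryTorsion 2 π r₀ = ⊤ := by
  haveI : Fact (Nat.Prime 2) := ⟨Nat.prime_two⟩
  obtain ⟨⟨θ, hθ⟩, hCM⟩ := FramePinning.exists_sq_eq_neg_seven_of_frame hd0 W hC hK hv hvbar hne hL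
  obtain ⟨hj, hjm, -, -, -⟩ := FramePinning.cm_data_of_smul_eq_cm7Twist W hd0 hC
  have heqv : IsHeckeConjEquivariant c ψ := DeuringShape.isHeckeConjEquivariant_of_pinned hK c hc hψ W (3 / 2) hL
  obtain ⟨Mv, Mvbar, hinf, hsup, hMv, hMvbar⟩ :=
    Deuring_galoisAction_cmPrimaryTorsion_split.exists_component hD W hjm K hCM c hc ψ hψ heqv hL 2 hv hvbar hne
  -- §1: the print's components are the eigen-summands for some root `ρ`
  obtain ⟨ρ, hρ, -, hEρ, hEρ'⟩ := endEigen_eq_of_complementary_cyclicLayers K W hj hθ π hrel hr₀ hsup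
    (hMvbar.endRing_mem _ π.2) hMvbar.exists_generator (hMv.endRing_mem _ π.2) hMv.exists_generator
  -- the component at `v̄` satisfies the pinning clause at `v`
  have hunits : ∀ u : 𝓞 K, IsUnit u → u = 1 ∨ u = -1 := eq_one_or_eq_neg_one_of_isUnit hK hθ
  have hclause : ∀ τ ∈ GreenbergSelmer.inertia v,
      ∀ x : ↥((W.baseChange K).endEigenPrimaryTorsion 2 π ρ), τ • x = x ∨ τ • x = -x := by
    intro τ hτ x
    rw [GreenbergSelmer.inertia, ← inertia_adicCompletionPrime_eq_map_absInertia] at hτ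
    have hx : (x : (W.baseChange K).geomPrimaryTorsion 2) ∈ Mvbar := hEρ ▸ x.2
    rcases hMvbar.smul_eq_self_or_eq_neg_of_inertia hunits hne.symm (adicCompletionPrime_mem_primesAbove K v) hτ
      with h | h
    · exact Or.inl (Subtype.ext (by rw [endEigenPrimaryTorsion.coe_smul]; exact h _ hx))
    · exact Or.inr (Subtype.ext (by rw [endEigenPrimaryTorsion.coe_smul, AddSubgroup.coe_neg]; exact h _ hx))
  have hρr : ρ = r₀ :=
    CMPrimes.endEigenPrimaryTorsion_two_pinningClause_unique W K hj hθ π hrel hr₀ v hv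
      (CMPrimes.inertiaDeg_eq_one_of_ne_two K hK.1 hv hvbar hne) hρ (Or.inl rfl) hclause hpin
  subst hρr
  refine ⟨hEρ ▸ hMvbar, hEρ' ▸ hMv, ?_, ?_⟩
  · rw [hEρ, hEρ']; exact hinf
  · rw [hEρ, hEρ']; exact hsup

/-! ## §3 Degree one: `𝓞_K/v̄ᵏ ≅ ℤ/2ᵏ` in a frame (every `a ∈ 𝓞_K` is an integer modulo `v̄ᵏ`) -/

/-- **`N(v̄) = 2`** for the two places `v ≠ v̄` above the split prime `2` of a quadratic field:
`N(v)·N(v̄) ∣ N((2)) = 4` with both factors `> 1`. [cite: NeukirchANT1999, Ch. I §8 Prop. (8.2)] -/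
theorem absNorm_eq_two_of_split (hK2 : Module.finrank ℚ K = 2)
    (hv : ((2 : ℕ) : 𝓞 K) ∈ v.asIdeal) (hvbar : ((2 : ℕ) : 𝓞 K) ∈ vbar.asIdeal) (hne : vbar ≠ v) :
    Ideal.absNorm vbar.asIdeal = 2 := by
  have hne' : v.asIdeal ≠ vbar.asIdeal := fun h ↦ hne (HeightOneSpectrum.ext h).symm
  have hcop : v.asIdeal ⊔ vbar.asIdeal = ⊤ := Ideal.IsMaximal.coprime_of_ne v.isMaximal vbar.isMaximal hne'
  have hmul : v.asIdeal * vbar.asIdeal = v.asIdeal ⊓ vbar.asIdeal := Ideal.mul_eq_inf_of_coprime hcop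
  have hle : Ideal.span {(2 : 𝓞 K)} ≤ v.asIdeal * vbar.asIdeal := by
    rw [hmul, Ideal.span_le, Set.singleton_subset_iff]
    exact ⟨by exact_mod_cast hv, by exact_mod_cast hvbar⟩
  have hdvd : Ideal.absNorm (v.asIdeal * vbar.asIdeal) ∣ Ideal.absNorm (Ideal.span {(2 : 𝓞 K)}) :=
    Ideal.absNorm_dvd_absNorm_of_le hle
  rw [map_mul, Ideal.absNorm_span_singleton] at hdvd
  have hn : (Algebra.norm ℤ (2 : 𝓞 K)).natAbs = 4 := by
    have h := Algebra.norm_algebraMap (S := 𝓞 K) (2 : ℤ)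
    rw [NumberField.RingOfIntegers.rank, hK2, map_ofNat] at h
    rw [h]; norm_num
  rw [hn] at hdvd
  have h1 : Ideal.absNorm v.asIdeal ≠ 1 := by rw [Ne, Ideal.absNorm_eq_one_iff]; exact v.isPrime.ne_top
  have h1' : Ideal.absNorm vbar.asIdeal ≠ 1 := by rw [Ne, Ideal.absNorm_eq_one_iff]; exact vbar.isPrime.ne_top
  have h0 : Ideal.absNorm v.asIdeal ≠ 0 := by rw [Ne, Ideal.absNorm_eq_zero_iff]; exact v.ne_bot
  have h0' : Ideal.absNorm vbar.asIdeal ≠ 0 := by rw [Ne, Ideal.absNorm_eq_zero_iff]; exact vbar.ne_bot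
  have hle4 : Ideal.absNorm v.asIdeal * Ideal.absNorm vbar.asIdeal ≤ 4 := Nat.le_of_dvd (by norm_num) hdvd
  have ha2 : 2 ≤ Ideal.absNorm v.asIdeal := by omega
  have h2b : 2 * Ideal.absNorm vbar.asIdeal ≤ 4 := le_trans (Nat.mul_le_mul_right _ ha2) hle4
  omega

omit [NumberField K] in
/-- **A quotient of order `2` has the two classes `0`, `1`**: `N(I) = 2 ⟹ x ∈ I ∨ x − 1 ∈ I`. [folklore] -/
theorem mem_or_sub_one_mem_of_absNorm_eq_two [NumberField K] {I : Ideal (𝓞 K)} (hI : Ideal.absNorm I = 2)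
    (x : 𝓞 K) : x ∈ I ∨ x - 1 ∈ I := by
  have hcard : Nat.card (𝓞 K ⧸ I) = 2 := by rw [← Submodule.cardQuot_apply, ← Ideal.absNorm_apply, hI]
  have hI1 : I ≠ ⊤ := by
    intro h; rw [h, Ideal.absNorm_top] at hI; exact absurd hI (by norm_num)
  haveI : Nontrivial (𝓞 K ⧸ I) := Ideal.Quotient.nontrivial_iff.mpr hI1
  obtain ⟨y, hy, huniq⟩ := (Nat.card_eq_two_iff' (0 : 𝓞 K ⧸ I)).mp hcard
  by_cases hx : Ideal.Quotient.mk I x = 0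
  · exact Or.inl (Ideal.Quotient.eq_zero_iff_mem.mp hx)
  · right
    have e1 : Ideal.Quotient.mk I x = 1 := (huniq _ hx).trans (huniq _ one_ne_zero).symm
    rw [← Ideal.Quotient.eq_zero_iff_mem, map_sub, map_one, e1, sub_self]

/-- **Every `a ∈ 𝓞_K` is congruent to a rational integer modulo `v̄ᵏ`** when `ord_{v̄} 2 = 1` and
`N(v̄) = 2` (`𝓞_K/v̄ᵏ ≅ ℤ/2ᵏ`: the unramified degree-one place). Induction on `k`: with
`N − a = 2ⁱ d + e`, `e ∈ v̄^{i+1}` (Mathlib `Ideal.exists_mul_add_mem_pow_succ`, `2ⁱ ∈ v̄ⁱ ∖ v̄^{i+1}`) and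
`d ≡ 0, 1 (mod v̄)`, correct `N` by `0` or `2ⁱ`. [cite: NeukirchANT1999, Ch. II §4 Prop. (4.3) (𝓞/𝔭ⁿ ≅ 𝓞_𝔭/𝔭ⁿ) and Ch. I §8]
-/
theorem exists_int_sub_mem_pow (h2 : vbar.intValuation (2 : 𝓞 K) = WithZero.exp (-1 : ℤ))
    (hN2 : Ideal.absNorm vbar.asIdeal = 2) (a : 𝓞 K) (k : ℕ) :
    ∃ N : ℤ, ((N : 𝓞 K) - a) ∈ vbar.asIdeal ^ k := by
  haveI := vbar.isPrime
  induction k with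
  | zero => exact ⟨0, by rw [pow_zero, Ideal.one_eq_top]; exact Submodule.mem_top⟩
  | succ i ih =>
    obtain ⟨N, hN⟩ := ih
    have h2mem : (2 : 𝓞 K) ∈ vbar.asIdeal := by
      rw [← HeightOneSpectrum.intValuation_lt_one_iff_mem, h2, ← WithZero.exp_zero, WithZero.exp_lt_exp]
      norm_num
    have hmem : (2 : 𝓞 K) ^ i ∈ vbar.asIdeal ^ i := Ideal.pow_mem_pow h2mem i
    have hexp : ∀ k : ℕ, (WithZero.exp (-1 : ℤ)) ^ k = WithZero.exp (-(k : ℤ)) := fun k ↦ by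
      induction k with
      | zero => rw [pow_zero, Nat.cast_zero, neg_zero, WithZero.exp_zero]
      | succ j ih => rw [pow_succ, ih, ← WithZero.exp_add]; congr 1; push_cast; ring
    have hnot : (2 : 𝓞 K) ^ i ∉ vbar.asIdeal ^ (i + 1) := by
      rw [← HeightOneSpectrum.intValuation_le_pow_iff_mem, map_pow, h2, hexp, WithZero.exp_le_exp]
      push_cast
      omega
    obtain ⟨dd, e, he, hde⟩ := Ideal.exists_mul_add_mem_pow_succ vbar.ne_bot ((2 : 𝓞 K) ^ i) ((N : 𝓞 K) - a)
      hmem hnot hN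
    rcases mem_or_sub_one_mem_of_absNorm_eq_two hN2 dd with hd | hd
    · refine ⟨N, ?_⟩
      rw [← hde, pow_succ]
      exact Ideal.add_mem _ (Ideal.mul_mem_mul hmem hd) (by rw [← pow_succ]; exact he)
    · refine ⟨N - 2 ^ i, ?_⟩
      have e1 : (((N - 2 ^ i : ℤ) : 𝓞 K) - a) = (2 : 𝓞 K) ^ i * (dd - 1) + e := by
        have e2 : (((N - 2 ^ i : ℤ) : 𝓞 K) - a) = ((N : 𝓞 K) - a) - 2 ^ i := by push_cast; ring
        rw [e2, ← hde]
        ring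
      rw [e1, pow_succ]
      exact Ideal.add_mem _ (Ideal.mul_mem_mul hmem hd) (by rw [← pow_succ]; exact he)

/-! ## §4 Consequences in the subtype currency of the stubs -/

/-- **(D-Gal), Frobenius part, on the pinned summand.** Granted the print: for every finite place `w ≠ v̄`
at which `ψ` is unramified and every infinite place `wi`, there is `a : 𝓞 K` with
`wi.embedding a = ψ.valueAtUniformizer w` and `(a) = w` such that EVERY arithmetic Frobenius `σ` at every
prime `𝔔 ∣ w` of `\bar ℤ_K` acts on `W* = ↥((W.baseChange K).endEigenPrimaryTorsion 2 π r₀)` at level `2ᵏ`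
as ANY integer `N ≡ a (mod v̄ᵏ)`: `σ • x = N • x` for `2ᵏ x = 0`. (Rubin Cor. 5.16 (ii): "`[𝔮, F(E[𝔟])/F]`
acts on `E[𝔟]` by multiplication by `ψ(𝔮)`", `𝔟 = v̄ᵏ`.) [cite: Rubin1999, §5 Cor. 5.16 (i)–(ii)] -/
theorem smul_eq_of_isArithFrobAt_of_pinned
    (hD : Deuring_galoisAction_cmPrimaryTorsion_split)
    (hd0 : d ≠ 0) (hC : C • W = cm7.quadraticTwist (d : ℚ)) (hK : IsImaginaryQuadratic K)
    (hv : ((2 : ℕ) : 𝓞 K) ∈ v.asIdeal) (hvbar : ((2 : ℕ) : 𝓞 K) ∈ vbar.asIdeal) (hne : vbar ≠ v)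
    (c : K ≃ₐ[ℚ] K) (hc : c ≠ 1) (hψ : ψ.HasInfinityType (fun _ ↦ 1) (fun _ ↦ 0))
    (hL : ∀ s : ℂ, 3 / 2 < s.re → heckeLFunction ψ s = W.LSeries s)
    (π : (W.baseChange K).endRing) (hrel : (π : AddMonoid.End (W.baseChange K).geomPoints) * π = π - 2)
    {r₀ : ℤ_[2]} (hr₀ : r₀ * r₀ = r₀ - 2)
    (hpin : ∀ τ ∈ GreenbergSelmer.inertia v,
      ∀ x : ↥((W.baseChange K).endEigenPrimaryTorsion 2 π r₀), τ • x = x ∨ τ • x = -x)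
    {w : HeightOneSpectrum (𝓞 K)} (hw : w ≠ vbar) (hunr : ψ.IsUnramifiedAt w) (wi : InfinitePlace K) :
    ∃ a : 𝓞 K, wi.embedding (a : K) = ψ.valueAtUniformizer w ∧ Ideal.span {a} = w.asIdeal ∧
      ∀ 𝔔 ∈ w.primesAbove, ∀ σ : absoluteGaloisGroup K, IsArithFrobAt (𝓞 K) σ 𝔔 →
        ∀ (k : ℕ) (N : ℤ), ((N : 𝓞 K) - a) ∈ vbar.asIdeal ^ k →
          ∀ x : ↥((W.baseChange K).endEigenPrimaryTorsion 2 π r₀), 2 ^ k • x = 0 → σ • x = N • x := by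
  obtain ⟨hP, -, -, -⟩ := isPrimaryComponent_endEigenPrimaryTorsion_of_pinned hD hd0 hC hK hv hvbar hne c hc
    hψ hL π hrel hr₀ hpin
  obtain ⟨a, ha, hspan, hact⟩ := hP.frobenius w hw hunr wi
  refine ⟨a, ha, hspan, fun 𝔔 h𝔔 σ hσ k N hN x hx ↦ Subtype.ext ?_⟩
  have hx' : 2 ^ k • (x : (W.baseChange K).geomPrimaryTorsion 2) = 0 := by
    have := congrArg Subtype.val hx
    simpa using this
  have h := hact 𝔔 h𝔔 σ hσ k N hN (x : (W.baseChange K).geomPrimaryTorsion 2) x.2 hx'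
  rw [endEigenPrimaryTorsion.coe_smul, h, AddSubgroupClass.coe_zsmul]

/-- **(D-Gal), Frobenius part, in the `∃`-form the twist step consumes**: granted the print, for every
`w ≠ v̄` at which `ψ` is unramified and every arithmetic Frobenius `σ` at a prime above `w`, AT EVERY LEVEL
`k` there IS an integer `N ≡ a_w (mod v̄ᵏ)` (`𝓞_K/v̄ᵏ ≅ ℤ/2ᵏ`, `exists_int_sub_mem_pow`) and `σ • x = N • x`
for all `x ∈ W*` with `2ᵏ x = 0` — the level-wise integer scalars of p664116
`CocyclicScalar.exists_continuousMonoidHom_forall_smul_eq`, now NAMED: `N ≡ ψ(ϖ_w)` read at `v̄`.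
[cite: Rubin1999, §5 Cor. 5.16 (i)–(ii)] -/
theorem exists_int_smul_eq_of_isArithFrobAt_of_pinned
    (hD : Deuring_galoisAction_cmPrimaryTorsion_split)
    (hd0 : d ≠ 0) (hC : C • W = cm7.quadraticTwist (d : ℚ)) (hK : IsImaginaryQuadratic K)
    (hv : ((2 : ℕ) : 𝓞 K) ∈ v.asIdeal) (hvbar : ((2 : ℕ) : 𝓞 K) ∈ vbar.asIdeal) (hne : vbar ≠ v)
    (c : K ≃ₐ[ℚ] K) (hc : c ≠ 1) (hψ : ψ.HasInfinityType (fun _ ↦ 1) (fun _ ↦ 0))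
    (hL : ∀ s : ℂ, 3 / 2 < s.re → heckeLFunction ψ s = W.LSeries s)
    (π : (W.baseChange K).endRing) (hrel : (π : AddMonoid.End (W.baseChange K).geomPoints) * π = π - 2)
    {r₀ : ℤ_[2]} (hr₀ : r₀ * r₀ = r₀ - 2)
    (hpin : ∀ τ ∈ GreenbergSelmer.inertia v,
      ∀ x : ↥((W.baseChange K).endEigenPrimaryTorsion 2 π r₀), τ • x = x ∨ τ • x = -x)
    {w : HeightOneSpectrum (𝓞 K)} (hw : w ≠ vbar) (hunr : ψ.IsUnramifiedAt w) (wi : InfinitePlace K) :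
    ∃ a : 𝓞 K, wi.embedding (a : K) = ψ.valueAtUniformizer w ∧ Ideal.span {a} = w.asIdeal ∧
      ∀ 𝔔 ∈ w.primesAbove, ∀ σ : absoluteGaloisGroup K, IsArithFrobAt (𝓞 K) σ 𝔔 →
        ∀ k : ℕ, ∃ N : ℤ, ((N : 𝓞 K) - a) ∈ vbar.asIdeal ^ k ∧
          ∀ x : ↥((W.baseChange K).endEigenPrimaryTorsion 2 π r₀), 2 ^ k • x = 0 → σ • x = N • x := by
  obtain ⟨⟨θ, hθ⟩, -⟩ := FramePinning.exists_sq_eq_neg_seven_of_frame hd0 W hC hK hv hvbar hne hL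
  have h2 := FirstLayer.intValuation_two_of_frame hK hθ hd0 W hC hvbar
  have hN2 := absNorm_eq_two_of_split hK.1 hv hvbar hne
  obtain ⟨a, ha, hspan, hact⟩ := smul_eq_of_isArithFrobAt_of_pinned hD hd0 hC hK hv hvbar hne c hc hψ hL π
    hrel hr₀ hpin hw hunr wi
  refine ⟨a, ha, hspan, fun 𝔔 h𝔔 σ hσ k ↦ ?_⟩
  obtain ⟨N, hN⟩ := exists_int_sub_mem_pow h2 hN2 a k
  exact ⟨N, hN, hact 𝔔 h𝔔 σ hσ k N hN⟩

/-- **Inertia at an unramified `w ≠ v̄` acts trivially on the pinned summand** (print: `ψ(U_w) = 1`; in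
particular `W*` is unramified at every good `w ∤ 2`, as `IsPAdicAvatarOf` requires of an avatar).
[cite: Rubin1999, §5 Thm. 5.15 (ii)–(iii)] -/
theorem smul_eq_self_of_inertia_of_pinned
    (hD : Deuring_galoisAction_cmPrimaryTorsion_split)
    (hd0 : d ≠ 0) (hC : C • W = cm7.quadraticTwist (d : ℚ)) (hK : IsImaginaryQuadratic K)
    (hv : ((2 : ℕ) : 𝓞 K) ∈ v.asIdeal) (hvbar : ((2 : ℕ) : 𝓞 K) ∈ vbar.asIdeal) (hne : vbar ≠ v)
    (c : K ≃ₐ[ℚ] K) (hc : c ≠ 1) (hψ : ψ.HasInfinityType (fun _ ↦ 1) (fun _ ↦ 0))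
    (hL : ∀ s : ℂ, 3 / 2 < s.re → heckeLFunction ψ s = W.LSeries s)
    (π : (W.baseChange K).endRing) (hrel : (π : AddMonoid.End (W.baseChange K).geomPoints) * π = π - 2)
    {r₀ : ℤ_[2]} (hr₀ : r₀ * r₀ = r₀ - 2)
    (hpin : ∀ τ ∈ GreenbergSelmer.inertia v,
      ∀ x : ↥((W.baseChange K).endEigenPrimaryTorsion 2 π r₀), τ • x = x ∨ τ • x = -x)
    {w : HeightOneSpectrum (𝓞 K)} (hw : w ≠ vbar) (hunr : ψ.IsUnramifiedAt w)
    {𝔔 : Ideal (absIntegers (𝓞 K) K)} (h𝔔 : 𝔔 ∈ w.primesAbove)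
    {σ : absoluteGaloisGroup K} (hσ : σ ∈ 𝔔.inertia (absoluteGaloisGroup K))
    (x : ↥((W.baseChange K).endEigenPrimaryTorsion 2 π r₀)) : σ • x = x := by
  obtain ⟨hP, -, -, -⟩ := isPrimaryComponent_endEigenPrimaryTorsion_of_pinned hD hd0 hC hK hv hvbar hne c hc
    hψ hL π hrel hr₀ hpin
  exact Subtype.ext (by
    rw [endEigenPrimaryTorsion.coe_smul]
    exact hP.smul_eq_self_of_inertia_of_isUnramifiedAt hw hunr h𝔔 hσ _ x.2)

/-- **Inertia at ANY `w ≠ v̄` acts on the pinned summand through `{±1}`** (print: through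
`ψ(U_w) ⊂ 𝓞_K^× = {±1}`): the pinning clause holds at every `w ≠ v̄` — at `v` (the stubs' clause), at the
places above `7` and at the odd prime divisors of `d` alike; uniformly in `x`. [cite: Rubin1999, §5 Thm. 5.15 (i)–(ii)] -/
theorem smul_eq_self_or_eq_neg_of_inertia_of_pinned
    (hD : Deuring_galoisAction_cmPrimaryTorsion_split)
    (hd0 : d ≠ 0) (hC : C • W = cm7.quadraticTwist (d : ℚ)) (hK : IsImaginaryQuadratic K)
    (hv : ((2 : ℕ) : 𝓞 K) ∈ v.asIdeal) (hvbar : ((2 : ℕ) : 𝓞 K) ∈ vbar.asIdeal) (hne : vbar ≠ v)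
    (c : K ≃ₐ[ℚ] K) (hc : c ≠ 1) (hψ : ψ.HasInfinityType (fun _ ↦ 1) (fun _ ↦ 0))
    (hL : ∀ s : ℂ, 3 / 2 < s.re → heckeLFunction ψ s = W.LSeries s)
    (π : (W.baseChange K).endRing) (hrel : (π : AddMonoid.End (W.baseChange K).geomPoints) * π = π - 2)
    {r₀ : ℤ_[2]} (hr₀ : r₀ * r₀ = r₀ - 2)
    (hpin : ∀ τ ∈ GreenbergSelmer.inertia v,
      ∀ x : ↥((W.baseChange K).endEigenPrimaryTorsion 2 π r₀), τ • x = x ∨ τ • x = -x)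
    {w : HeightOneSpectrum (𝓞 K)} (hw : w ≠ vbar)
    {𝔔 : Ideal (absIntegers (𝓞 K) K)} (h𝔔 : 𝔔 ∈ w.primesAbove)
    {σ : absoluteGaloisGroup K} (hσ : σ ∈ 𝔔.inertia (absoluteGaloisGroup K)) :
    (∀ x : ↥((W.baseChange K).endEigenPrimaryTorsion 2 π r₀), σ • x = x) ∨
      (∀ x : ↥((W.baseChange K).endEigenPrimaryTorsion 2 π r₀), σ • x = -x) := by
  obtain ⟨⟨θ, hθ⟩, -⟩ := FramePinning.exists_sq_eq_neg_seven_of_frame hd0 W hC hK hv hvbar hne hL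
  obtain ⟨hP, -, -, -⟩ := isPrimaryComponent_endEigenPrimaryTorsion_of_pinned hD hd0 hC hK hv hvbar hne c hc
    hψ hL π hrel hr₀ hpin
  rcases hP.smul_eq_self_or_eq_neg_of_inertia (eq_one_or_eq_neg_one_of_isUnit hK hθ) hw h𝔔 hσ with h | h
  · exact Or.inl fun x ↦ Subtype.ext (by rw [endEigenPrimaryTorsion.coe_smul]; exact h _ x.2)
  · exact Or.inr fun x ↦ Subtype.ext (by
      rw [endEigenPrimaryTorsion.coe_smul, AddSubgroup.coe_neg]; exact h _ x.2)

/-- **The pinning clause transported to `GreenbergSelmer.inertia w` for every `w ≠ v̄`** (the currency of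
`stub_restrictedControl_two`'s hypothesis, now at all `w ≠ v̄`). [cite: Rubin1999, §5 Thm. 5.15 (i)–(ii)] -/
theorem pinningClause_of_pinned_of_ne
    (hD : Deuring_galoisAction_cmPrimaryTorsion_split)
    (hd0 : d ≠ 0) (hC : C • W = cm7.quadraticTwist (d : ℚ)) (hK : IsImaginaryQuadratic K)
    (hv : ((2 : ℕ) : 𝓞 K) ∈ v.asIdeal) (hvbar : ((2 : ℕ) : 𝓞 K) ∈ vbar.asIdeal) (hne : vbar ≠ v)
    (c : K ≃ₐ[ℚ] K) (hc : c ≠ 1) (hψ : ψ.HasInfinityType (fun _ ↦ 1) (fun _ ↦ 0))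
    (hL : ∀ s : ℂ, 3 / 2 < s.re → heckeLFunction ψ s = W.LSeries s)
    (π : (W.baseChange K).endRing) (hrel : (π : AddMonoid.End (W.baseChange K).geomPoints) * π = π - 2)
    {r₀ : ℤ_[2]} (hr₀ : r₀ * r₀ = r₀ - 2)
    (hpin : ∀ τ ∈ GreenbergSelmer.inertia v,
      ∀ x : ↥((W.baseChange K).endEigenPrimaryTorsion 2 π r₀), τ • x = x ∨ τ • x = -x)
    {w : HeightOneSpectrum (𝓞 K)} (hw : w ≠ vbar) :
    ∀ τ ∈ GreenbergSelmer.inertia w,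
      ∀ x : ↥((W.baseChange K).endEigenPrimaryTorsion 2 π r₀), τ • x = x ∨ τ • x = -x := by
  intro τ hτ x
  rw [GreenbergSelmer.inertia, ← inertia_adicCompletionPrime_eq_map_absInertia] at hτ
  rcases smul_eq_self_or_eq_neg_of_inertia_of_pinned hD hd0 hC hK hv hvbar hne c hc hψ hL π hrel hr₀ hpin hw
      (adicCompletionPrime_mem_primesAbove K w) hτ with h | h
  · exact Or.inl (h x)
  · exact Or.inr (h x)

end Frame

end Summit.BirchSwinnertonDyer.Rank1Residual.P2.DeuringGaloisSummand

end
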